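import Summits.Ventures.Crystal3D.Theorems.StickyWulffConstantPolycrystalWulffBoundTwinFreePincers
import Summits.Ventures.Crystal3D.Theorems.StickyWulffConstantPolycrystalWulffBoundRungDominantTwinFree
import Summits.Ventures.Crystal3D.Theorems.StickyWulffConstantPolycrystalWulffBoundTwoClassArith

/-!
# `PolycrystalWulffBound`, line `PolyDensity`: ALL twin-free polyhedral textures with generic walls
# charged `≥ 2` satisfy the polycrystal Wulff bound — UNCONDITIONALLY, any number of lattice classes
# (crux `stmt-Ventures-19482`; lane poly-p2, gen 23)

Route `StickyWulffConstant` of the venture `Summits/Ventures/Crystal3D`, second prover lane.  The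
all-classes twin-free rung of record, `rung_twinFree_allClasses_of_WulffOverlap27_8` (poly-p2 g4/g7),
holds at the crux's generic charge `1` MODULO the certified overlap constant CH-P1′ (`WulffOverlap27_8`,
numerical) and the kernel-EVALUATED aggregated LP certificate `AggCert27_8` (`native_decide`).  Trading
wall charge for certificates, NO certificate at all is needed once the generic walls are charged `≥ 2`:

* `sum_rpow_two_thirds_ge_of_noDominant` : class volumes `v_ℓ ≥ 0`, `V = Σ v_ℓ`, every `v_ℓ < (17/20)·V`
  ⟹ `Σ v_ℓ^{2/3} ≥ 1.17·V^{2/3}` (largest class `≤ V/2`: every class is `≤ V/2`, gain `2^{1/3}`;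
  largest class `> V/2`: it and the rest are both `≥ (3/20)·V`, gain `(17/20)^{2/3} + (3/20)^{2/3} ≥ 1.1796`,
  the rest's classes merged by subadditivity of `v^{2/3}`);
* `bulk_pincer_arith_charged` / `rung_twinFree_bulk_charged` : the bulk rung (`rung_twinFree_bulk`, g3:
  first pincer `√3·Per(E) + (c₁/2)·D ≤ En` against second pincer `Σ w(v_ℓ) − (√5 − c₁/2)·D ≤ En`) at
  charge `c₁ = 2` closes already at `Σ v_ℓ^{2/3} ≥ 1.17·Vol^{2/3}` (threshold `1.43` at charge `1`;
  margin `0.9 %`);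
* `rung_twinFree_allClasses_charged` : **every twin-free polyhedral crux texture whose generic walls
  carry charge `≥ 2` satisfies `6·2^{1/3}(√2·Vol)^{2/3} ≤ En`** — a dominant class (`≥ 17/20`) is
  `rung_dominantTwinFree` (g3, charge `≥ 1` suffices), otherwise the bulk rung at charge `2`.
  Standard axioms only: no `native_decide`, no named fact, no certificate.

LADDER (kernel status of the ALL-GENERIC class after this gen): charge `≥ 2` unconditional (this file);
two lattices at charge `≥ 6/5` unconditional (`…RungTwinFreeTwoClassesCharged`); charge `≥ 1` (the crux
text) modulo CH-P1′ + `AggCert27_8`; necessary `≥ √5 − √3 ≈ 0.504` (paper).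
WHAT THIS IS NOT: anything at charge `< 2` for three or more lattices without certificates; twins; the
crux is not claimed.
-/

noncomputable section

open scoped BigOperators InnerProductSpace ENNReal
open MeasureTheory Filter Finset

namespace Summit.Ventures.Crystal3D.Cruxes.PolycrystalWulffBound.PolyDensity

open Summit.Ventures.Crystal3D.Theorems
open Summit.Ventures.Crystal3D.Cruxes.TextureLiminf.TexShadow (per polytope E3)
open Literature.MathematicalPhysics.StatisticalMechanics (perimeter)

/-! ### Concavity casework: no dominant class -/

/-- `1.2599 ≤ (1/2)^{-1/3}` (`= 2^{1/3}`). -/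
theorem rpow_half_neg_third_ge : (1.2599 : ℝ) ≤ (1 / 2 : ℝ) ^ (-(1 : ℝ) / 3) := by
  set t : ℝ := (1 / 2 : ℝ) ^ (-(1 : ℝ) / 3) with ht
  have ht0 : 0 ≤ t := by positivity
  have ht3 : t ^ 3 = 2 := by
    rw [ht, ← Real.rpow_natCast _ 3, ← Real.rpow_mul (by norm_num)]
    norm_num
  by_contra h
  rw [not_le] at h
  have h3 : t ^ 3 < (1.2599 : ℝ) ^ 3 := by gcongr
  rw [ht3] at h3
  norm_num at h3

/-- **No dominant class ⟹ bulk.**  For class volumes `v ℓ ≥ 0` with `V = Σ v ℓ` and every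
`v ℓ < (17/20)·V`: `1.17·V^{2/3} ≤ Σ (v ℓ)^{2/3}`. -/
theorem sum_rpow_two_thirds_ge_of_noDominant {κ : Type*} (s : Finset κ) {v : κ → ℝ} {V : ℝ}
    (hV : V = ∑ i ∈ s, v i) (hv : ∀ i ∈ s, 0 ≤ v i) (hnd : ∀ i ∈ s, v i < 17 / 20 * V) :
    (1.17 : ℝ) * V ^ ((2 : ℝ) / 3) ≤ ∑ i ∈ s, v i ^ ((2 : ℝ) / 3) := by
  classical
  have hV0 : 0 ≤ V := by rw [hV]; exact sum_nonneg hv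
  rcases s.eq_empty_or_nonempty with hs | hne
  · subst hs
    simp only [sum_empty] at hV ⊢
    rw [hV, Real.zero_rpow (by norm_num), mul_zero]
  obtain ⟨ℓ₁, hℓ₁, hmax⟩ := exists_max_image s v hne
  have hW0 : 0 ≤ V ^ ((2 : ℝ) / 3) := by positivity
  by_cases hhalf : v ℓ₁ ≤ 1 / 2 * V
  · -- every class is at most half the volume: gain `2^{1/3}`
    have hsmall : ∀ i ∈ s, v i ≤ 1 / 2 * V := fun i hi => (hmax i hi).trans hhalf
    have h := sum_rpow_two_thirds_ge s (by norm_num : (0 : ℝ) < 1 / 2) hV hv hsmall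
    have h2 := rpow_half_neg_third_ge
    nlinarith [mul_le_mul_of_nonneg_right h2 hW0]
  · -- a largest class above half the volume: it and the rest are both `≥ (3/20)·V`
    rw [not_le] at hhalf
    set R : ℝ := ∑ i ∈ s.erase ℓ₁, v i with hR
    have hsplit : V = v ℓ₁ + R := by rw [hV, hR, ← add_sum_erase s v hℓ₁]
    have hvR : ∀ i ∈ s.erase ℓ₁, 0 ≤ v i := fun i hi => hv i (mem_of_mem_erase hi)
    have hR0 : 0 ≤ R := sum_nonneg hvR
    have hrest : (1 : ℝ) ^ (-(1 : ℝ) / 3) * R ^ ((2 : ℝ) / 3) ≤ ∑ i ∈ s.erase ℓ₁, v i ^ ((2 : ℝ) / 3) :=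
      sum_rpow_two_thirds_ge (s.erase ℓ₁) one_pos rfl hvR
        (fun i hi => by rw [one_mul]; exact single_le_sum hvR hi)
    rw [Real.one_rpow, one_mul] at hrest
    have h1 : 3 / 20 * V ≤ v ℓ₁ := by linarith
    have h2 : 3 / 20 * V ≤ R := by have := hnd ℓ₁ hℓ₁; linarith
    have hkey := rpow_two_thirds_two_classes hsplit h1 h2
    have h17 := rpow_seventeen_twentieths_lower
    have h3 := rpow_three_twentieths_lower
    rw [← add_sum_erase s (fun i => v i ^ ((2 : ℝ) / 3)) hℓ₁]
    have hsum : (1.1796 : ℝ) * V ^ ((2 : ℝ) / 3) ≤ v ℓ₁ ^ ((2 : ℝ) / 3) + R ^ ((2 : ℝ) / 3) := by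
      nlinarith [hkey, h17, h3, hW0]
    linarith

/-! ### The bulk rung at charge `2` -/

/-- **Bulk arithmetic at charge `2`.**  Let `c > 0` with `c³ ≥ 36π`, class volumes `v ℓ ≥ 0`, `V ≥ 0`
with `1.17·V^{2/3} ≤ Σ (v ℓ)^{2/3}`, free area `F ≥ c V^{2/3}`, `D ≥ 0`, and an energy `En` with
`√3 F + D ≤ En` and `Σ_ℓ 6·2^{1/3}(√2 v ℓ)^{2/3} − (√5 − 1) D ≤ En`.  Then `6·2^{1/3}(√2 V)^{2/3} ≤ En`
(weights `1.2361 : 1`; margin `0.9 %`). -/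
theorem bulk_pincer_arith_charged {κ : Type*} (s : Finset κ) {v : κ → ℝ} {c V F D En : ℝ} (hc : 0 < c)
    (hc3 : 36 * Real.pi ≤ c ^ 3) (hV0 : 0 ≤ V) (hv : ∀ i ∈ s, 0 ≤ v i)
    (hbulk : (1.17 : ℝ) * V ^ ((2 : ℝ) / 3) ≤ ∑ i ∈ s, v i ^ ((2 : ℝ) / 3))
    (hF : c * V ^ ((2 : ℝ) / 3) ≤ F) (hD : 0 ≤ D)
    (h1 : Real.sqrt 3 * F + D ≤ En)
    (h2 : (∑ i ∈ s, 6 * (2 : ℝ) ^ ((1 : ℝ) / 3) * (Real.sqrt 2 * v i) ^ ((2 : ℝ) / 3)) -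
      (Real.sqrt 5 - 1) * D ≤ En) :
    6 * (2 : ℝ) ^ ((1 : ℝ) / 3) * (Real.sqrt 2 * V) ^ ((2 : ℝ) / 3) ≤ En := by
  rw [wulffConstant_eq' hV0]
  obtain ⟨ht1, ht2, -⟩ := cbrt_two_bounds
  set t : ℝ := (2 : ℝ) ^ ((1 : ℝ) / 3) with ht
  have ht0 : 0 ≤ t := by positivity
  set W : ℝ := V ^ ((2 : ℝ) / 3) with hW
  have hW0 : 0 ≤ W := by positivity
  set Q : ℝ := ∑ i ∈ s, v i ^ ((2 : ℝ) / 3) with hQ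
  have hQ0 : 0 ≤ Q := sum_nonneg fun i hi => Real.rpow_nonneg (hv i hi) _
  have hsum : (∑ i ∈ s, 6 * (2 : ℝ) ^ ((1 : ℝ) / 3) * (Real.sqrt 2 * v i) ^ ((2 : ℝ) / 3)) =
      6 * t ^ 2 * Q := by
    rw [hQ, mul_sum]
    refine sum_congr rfl fun i hi => ?_
    rw [wulffConstant_eq' (hv i hi)]
  rw [hsum] at h2
  have h3 : (1.732 : ℝ) ≤ Real.sqrt 3 := sqrt_three_lower
  have h5 : Real.sqrt 5 ≤ (2.2361 : ℝ) := sqrt_five_upper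
  have hc1 : (4.835 : ℝ) ≤ c := isoConst_lower hc hc3
  have hFW : c * W ≤ F := hF
  have p1 : Real.sqrt 5 * D ≤ 2.2361 * D := mul_le_mul_of_nonneg_right h5 hD
  have p2 : t ^ 2 * ((1.17 : ℝ) * W) ≤ t ^ 2 * Q := mul_le_mul_of_nonneg_left hbulk (sq_nonneg t)
  have ht2l : (1.2599 : ℝ) ^ 2 ≤ t ^ 2 := by gcongr
  have ht2u : t ^ 2 ≤ (1.25993 : ℝ) ^ 2 := by gcongr
  have p3 : (1.2599 : ℝ) ^ 2 * ((1.17 : ℝ) * W) ≤ t ^ 2 * ((1.17 : ℝ) * W) :=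
    mul_le_mul_of_nonneg_right ht2l (by positivity)
  have p5 : Real.sqrt 3 * (c * W) ≤ Real.sqrt 3 * F := mul_le_mul_of_nonneg_left hFW (Real.sqrt_nonneg 3)
  have p6 : (1.732 : ℝ) * (c * W) ≤ Real.sqrt 3 * (c * W) :=
    mul_le_mul_of_nonneg_right h3 (mul_nonneg hc.le hW0)
  have p7 : (4.835 : ℝ) * W ≤ c * W := mul_le_mul_of_nonneg_right hc1 hW0
  have p8 : t ^ 2 * W ≤ (1.25993 : ℝ) ^ 2 * W := mul_le_mul_of_nonneg_right ht2u hW0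
  nlinarith [p1, p2, p3, p5, p6, p7, p8, hD, hW0, hQ0, h1, h2]

/-- **The bulk rung at generic charge `≥ 2`**: a twin-free polyhedral crux texture with
`1.17·Vol^{2/3} ≤ Σ_classes v_ℓ^{2/3}` whose generic walls carry charge `≥ 2` satisfies the polycrystal
Wulff bound (first + second pincer of `twinFree_pincers_charged`, `bulk_pincer_arith_charged`). -/
theorem rung_twinFree_bulk_charged :
    let Λ : Set (EuclideanSpace ℝ (Fin 3)) := Literature.MathematicalPhysics.StatisticalMechanics.fccStacking 1 (Real.sqrt (2 / 3));
    let Brl : (ℤ → ℤ) → Set (EuclideanSpace ℝ (Fin 3)) := Literature.MathematicalPhysics.StatisticalMechanics.barlowStacking 1 (Real.sqrt (2 / 3));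
    let Ax : EuclideanSpace ℝ (Fin 3) → (EuclideanSpace ℝ (Fin 3) ≃ₗᵢ[ℝ] EuclideanSpace ℝ (Fin 3)) → (EuclideanSpace ℝ (Fin 3) ≃ₗᵢ[ℝ] EuclideanSpace ℝ (Fin 3)) → Prop := fun m A B => ∃ (L : EuclideanSpace ℝ (Fin 3) ≃ₗᵢ[ℝ] EuclideanSpace ℝ (Fin 3)) (s₁ s₂ : EuclideanSpace ℝ (Fin 3)) (σ σ' : ℤ → ℤ), Literature.MathematicalPhysics.StatisticalMechanics.IsHaggSeq σ ∧ Literature.MathematicalPhysics.StatisticalMechanics.IsHaggSeq σ' ∧ L (EuclideanSpace.single (2 : Fin 3) (1 : ℝ)) = m ∧ A '' Λ ⊆ (fun q => L q + s₁) '' Brl σ ∧ B '' Λ ⊆ (fun q => L q + s₂) '' Brl σ';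
    let CoAx : (EuclideanSpace ℝ (Fin 3) ≃ₗᵢ[ℝ] EuclideanSpace ℝ (Fin 3)) → (EuclideanSpace ℝ (Fin 3) ≃ₗᵢ[ℝ] EuclideanSpace ℝ (Fin 3)) → Prop := fun A B => ∃ m, Ax m A B;
    let Φ : EuclideanSpace ℝ (Fin 3) → ℝ := fun ν => Real.sqrt 2 / 4 * ∑ᶠ w ∈ {w ∈ Λ | ‖w‖ = 1}, |⟪w, ν⟫_ℝ|;
    let Per : Set (EuclideanSpace ℝ (Fin 3)) → Set (EuclideanSpace ℝ (Fin 3)) → ℝ := fun K S => (⨆ (ξ : EuclideanSpace ℝ (Fin 3) → EuclideanSpace ℝ (Fin 3)) (_ : ContDiff ℝ 1 ξ ∧ HasCompactSupport ξ ∧ ∀ z, ξ z ∈ K), ENNReal.ofReal (∫ z in S, Literature.MathematicalPhysics.StatisticalMechanics.fieldDivergence ξ z)).toReal;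
    let ι : Set (EuclideanSpace ℝ (Fin 3)) → Set (EuclideanSpace ℝ (Fin 3)) → Set (EuclideanSpace ℝ (Fin 3)) → ℝ := fun K S₁ S₂ => (Per K S₁ + Per K S₂ - Per K (S₁ ∪ S₂)) / 2;
    let W : (EuclideanSpace ℝ (Fin 3) ≃ₗᵢ[ℝ] EuclideanSpace ℝ (Fin 3)) → Set (EuclideanSpace ℝ (Fin 3)) := fun A => {y | ∀ ν : EuclideanSpace ℝ (Fin 3), ⟪y, ν⟫_ℝ ≤ Φ (A.symm ν)};
    let Dsc : EuclideanSpace ℝ (Fin 3) → Set (EuclideanSpace ℝ (Fin 3)) := fun m => {y | ‖y‖ ≤ 1 ∧ ⟪y, m⟫_ℝ = 0};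
    let Tex : (n : ℕ) → (Fin n → Set (EuclideanSpace ℝ (Fin 3))) → (Fin n → (EuclideanSpace ℝ (Fin 3) ≃ₗᵢ[ℝ] EuclideanSpace ℝ (Fin 3))) → (Fin n → Fin n → ℝ) → (Fin n → Fin n → EuclideanSpace ℝ (Fin 3)) → Prop := fun n G A c m => (∀ f : Fin n, Literature.MathematicalPhysics.StatisticalMechanics.HasFinitePerimeter (G f) ∧ volume (G f) < ⊤) ∧ (∀ f g, f ≠ g → Disjoint (G f) (G g)) ∧ (∀ f g, f ≠ g → 0 ≤ c f g) ∧ (∀ f g, f ≠ g → ¬ CoAx (A f) (A g) → m f g = 0 ∧ 1 ≤ c f g) ∧ (∀ f g, f ≠ g → CoAx (A f) (A g) → A f '' Λ ≠ A g '' Λ → Ax (m f g) (A f) (A g) ∧ 1 / 2 ≤ c f g);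
    let En : (n : ℕ) → (Fin n → Set (EuclideanSpace ℝ (Fin 3))) → (Fin n → (EuclideanSpace ℝ (Fin 3) ≃ₗᵢ[ℝ] EuclideanSpace ℝ (Fin 3))) → (Fin n → Fin n → ℝ) → (Fin n → Fin n → EuclideanSpace ℝ (Fin 3)) → ℝ := fun n G A c m => ∑ f : Fin n, Per (W (A f)) (G f) - ∑ f, ∑ g, (if f = g then 0 else ι (W (A f)) (G f) (G g)) + ∑ f, ∑ g, (if f = g then 0 else c f g / 2 * ι (Dsc (m f g)) (G f) (G g));
    let Vol : (n : ℕ) → (Fin n → Set (EuclideanSpace ℝ (Fin 3))) → ℝ := fun n G => (volume (⋃ f : Fin n, G f)).toReal;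
    let Poly : Set (EuclideanSpace ℝ (Fin 3)) → Prop := fun S => ∃ (k : ℕ) (H : Fin k → Finset ((EuclideanSpace ℝ (Fin 3)) × ℝ)), S = ⋃ i, ⋂ p ∈ H i, {x | ⟪p.1, x⟫_ℝ < p.2};
    let TF : (n : ℕ) → (Fin n → (EuclideanSpace ℝ (Fin 3) ≃ₗᵢ[ℝ] EuclideanSpace ℝ (Fin 3))) → Prop := fun n A => ∀ f g : Fin n, f ≠ g → CoAx (A f) (A g) → A f '' Λ = A g '' Λ;
    ∀ (n : ℕ) (G : Fin n → Set (EuclideanSpace ℝ (Fin 3))) (A : Fin n → (EuclideanSpace ℝ (Fin 3) ≃ₗᵢ[ℝ] EuclideanSpace ℝ (Fin 3))) (c : Fin n → Fin n → ℝ) (m : Fin n → Fin n → EuclideanSpace ℝ (Fin 3)), Tex n G A c m → (∀ f, Poly (G f)) → TF n A → (∀ f g : Fin n, f ≠ g → ¬ CoAx (A f) (A g) → (2 : ℝ) ≤ c f g) → ((1.17 : ℝ) * (Vol n G) ^ ((2 : ℝ) / 3) ≤ ∑ ℓ ∈ Finset.univ.image (fun f : Fin n => A f '' Λ), ((volume (⋃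 f ∈ Finset.univ.filter (fun f : Fin n => A f '' Λ = ℓ), G f)).toReal) ^ ((2 : ℝ) / 3)) → 6 * (2 : ℝ) ^ ((1 : ℝ) / 3) * (Real.sqrt 2 * Vol n G) ^ ((2 : ℝ) / 3) ≤ En n G A c m := by
  intro Λ Brl Ax CoAx Φ Per ι W Dsc Tex En Vol Poly TF n G A c m hTex hPoly hTF hCh hbulk
  classical
  obtain ⟨D, hD0, h1, h2, -, hV⟩ := twinFree_pincers_charged 2 n G A c m hTex hPoly hTF hCh
  obtain ⟨hfin, hdisj, -, -, -⟩ := hTex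
  obtain ⟨hEm, hEv, hEp, -⟩ := texture_union_facts G hfin hdisj
  have hiso : 3 * (Real.pi * 4 / 3) ^ ((1 : ℝ) / 3) * (Vol n G) ^ ((2 : ℝ) / 3) ≤
      (perimeter (⋃ f, G f)).toReal := isoperimetric_toReal_three hEm hEv hEp
  have hVnn : 0 ≤ Vol n G := ENNReal.toReal_nonneg
  have h1' : Real.sqrt 3 * (perimeter (⋃ f, G f)).toReal + D ≤ En n G A c m := by
    have := h1; linarith
  have h2' : (∑ ℓ ∈ Finset.univ.image (fun f : Fin n => A f '' Λ), 6 * (2 : ℝ) ^ ((1 : ℝ) / 3) *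
      (Real.sqrt 2 * (volume (⋃ f ∈ Finset.univ.filter (fun f : Fin n => A f '' Λ = ℓ), G f)).toReal) ^
        ((2 : ℝ) / 3)) - (Real.sqrt 5 - 1) * D ≤ En n G A c m := by
    have := h2; linarith
  exact bulk_pincer_arith_charged _ isoConst_three_pos (le_of_eq isoConst_three_cube.symm) hVnn
    (fun ℓ _ => ENNReal.toReal_nonneg) hbulk hiso hD0 h1' h2'

/-! ### All twin-free textures at charge `≥ 2` -/

/-- **Every twin-free polyhedral crux texture whose generic walls carry charge `≥ 2` satisfies the
polycrystal Wulff bound — unconditionally, for any number of lattice classes.**  A dominant class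
(`≥ 17/20` of the volume) is `rung_dominantTwinFree`; otherwise `Σ_classes v_ℓ^{2/3} ≥ 1.17·Vol^{2/3}`
(`sum_rpow_two_thirds_ge_of_noDominant`) and `rung_twinFree_bulk_charged` applies. -/
theorem rung_twinFree_allClasses_charged :
    let Λ : Set (EuclideanSpace ℝ (Fin 3)) := Literature.MathematicalPhysics.StatisticalMechanics.fccStacking 1 (Real.sqrt (2 / 3));
    let Brl : (ℤ → ℤ) → Set (EuclideanSpace ℝ (Fin 3)) := Literature.MathematicalPhysics.StatisticalMechanics.barlowStacking 1 (Real.sqrt (2 / 3));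
    let Ax : EuclideanSpace ℝ (Fin 3) → (EuclideanSpace ℝ (Fin 3) ≃ₗᵢ[ℝ] EuclideanSpace ℝ (Fin 3)) → (EuclideanSpace ℝ (Fin 3) ≃ₗᵢ[ℝ] EuclideanSpace ℝ (Fin 3)) → Prop := fun m A B => ∃ (L : EuclideanSpace ℝ (Fin 3) ≃ₗᵢ[ℝ] EuclideanSpace ℝ (Fin 3)) (s₁ s₂ : EuclideanSpace ℝ (Fin 3)) (σ σ' : ℤ → ℤ), Literature.MathematicalPhysics.StatisticalMechanics.IsHaggSeq σ ∧ Literature.MathematicalPhysics.StatisticalMechanics.IsHaggSeq σ' ∧ L (EuclideanSpace.single (2 : Fin 3) (1 : ℝ)) = m ∧ A '' Λ ⊆ (fun q => L q + s₁) '' Brl σ ∧ B '' Λ ⊆ (fun q => L q + s₂) '' Brl σ';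
    let CoAx : (EuclideanSpace ℝ (Fin 3) ≃ₗᵢ[ℝ] EuclideanSpace ℝ (Fin 3)) → (EuclideanSpace ℝ (Fin 3) ≃ₗᵢ[ℝ] EuclideanSpace ℝ (Fin 3)) → Prop := fun A B => ∃ m, Ax m A B;
    let Φ : EuclideanSpace ℝ (Fin 3) → ℝ := fun ν => Real.sqrt 2 / 4 * ∑ᶠ w ∈ {w ∈ Λ | ‖w‖ = 1}, |⟪w, ν⟫_ℝ|;
    let Per : Set (EuclideanSpace ℝ (Fin 3)) → Set (EuclideanSpace ℝ (Fin 3)) → ℝ := fun K S => (⨆ (ξ : EuclideanSpace ℝ (Fin 3) → EuclideanSpace ℝ (Fin 3)) (_ : ContDiff ℝ 1 ξ ∧ HasCompactSupport ξ ∧ ∀ z, ξ z ∈ K), ENNReal.ofReal (∫ z in S, Literature.MathematicalPhysics.StatisticalMechanics.fieldDivergence ξ z)).toReal;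
    let ι : Set (EuclideanSpace ℝ (Fin 3)) → Set (EuclideanSpace ℝ (Fin 3)) → Set (EuclideanSpace ℝ (Fin 3)) → ℝ := fun K S₁ S₂ => (Per K S₁ + Per K S₂ - Per K (S₁ ∪ S₂)) / 2;
    let W : (EuclideanSpace ℝ (Fin 3) ≃ₗᵢ[ℝ] EuclideanSpace ℝ (Fin 3)) → Set (EuclideanSpace ℝ (Fin 3)) := fun A => {y | ∀ ν : EuclideanSpace ℝ (Fin 3), ⟪y, ν⟫_ℝ ≤ Φ (A.symm ν)};
    let Dsc : EuclideanSpace ℝ (Fin 3) → Set (EuclideanSpace ℝ (Fin 3)) := fun m => {y | ‖y‖ ≤ 1 ∧ ⟪y, m⟫_ℝ = 0};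
    let Tex : (n : ℕ) → (Fin n → Set (EuclideanSpace ℝ (Fin 3))) → (Fin n → (EuclideanSpace ℝ (Fin 3) ≃ₗᵢ[ℝ] EuclideanSpace ℝ (Fin 3))) → (Fin n → Fin n → ℝ) → (Fin n → Fin n → EuclideanSpace ℝ (Fin 3)) → Prop := fun n G A c m => (∀ f : Fin n, Literature.MathematicalPhysics.StatisticalMechanics.HasFinitePerimeter (G f) ∧ volume (G f) < ⊤) ∧ (∀ f g, f ≠ g → Disjoint (G f) (G g)) ∧ (∀ f g, f ≠ g → 0 ≤ c f g) ∧ (∀ f g, f ≠ g → ¬ CoAx (A f) (A g) → m f g = 0 ∧ 1 ≤ c f g) ∧ (∀ f g, f ≠ g → CoAx (A f) (A g) → A f '' Λ ≠ A g '' Λ → Ax (m f g) (A f) (A g) ∧ 1 / 2 ≤ c f g);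
    let En : (n : ℕ) → (Fin n → Set (EuclideanSpace ℝ (Fin 3))) → (Fin n → (EuclideanSpace ℝ (Fin 3) ≃ₗᵢ[ℝ] EuclideanSpace ℝ (Fin 3))) → (Fin n → Fin n → ℝ) → (Fin n → Fin n → EuclideanSpace ℝ (Fin 3)) → ℝ := fun n G A c m => ∑ f : Fin n, Per (W (A f)) (G f) - ∑ f, ∑ g, (if f = g then 0 else ι (W (A f)) (G f) (G g)) + ∑ f, ∑ g, (if f = g then 0 else c f g / 2 * ι (Dsc (m f g)) (G f) (G g));
    let Vol : (n : ℕ) → (Fin n → Set (EuclideanSpace ℝ (Fin 3))) → ℝ := fun n G => (volume (⋃ f : Fin n, G f)).toReal;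
    let Poly : Set (EuclideanSpace ℝ (Fin 3)) → Prop := fun S => ∃ (k : ℕ) (H : Fin k → Finset ((EuclideanSpace ℝ (Fin 3)) × ℝ)), S = ⋃ i, ⋂ p ∈ H i, {x | ⟪p.1, x⟫_ℝ < p.2};
    let TF : (n : ℕ) → (Fin n → (EuclideanSpace ℝ (Fin 3) ≃ₗᵢ[ℝ] EuclideanSpace ℝ (Fin 3))) → Prop := fun n A => ∀ f g : Fin n, f ≠ g → CoAx (A f) (A g) → A f '' Λ = A g '' Λ;
    ∀ (n : ℕ) (G : Fin n → Set (EuclideanSpace ℝ (Fin 3))) (A : Fin n → (EuclideanSpace ℝ (Fin 3) ≃ₗᵢ[ℝ] EuclideanSpace ℝ (Fin 3))) (c : Fin n → Fin n → ℝ) (m : Fin n → Fin n → EuclideanSpace ℝ (Fin 3)), Tex n G A c m → (∀ f, Poly (G f)) → TF n A → (∀ f g : Fin n, f ≠ g → ¬ CoAx (A f) (A g) → (2 : ℝ) ≤ c f g) → 6 * (2 : ℝ) ^ ((1 : ℝ) / 3) * (Real.sqrt 2 * Vol n G) ^ ((2 : ℝ) / 3) ≤ En n G A c m := by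
  intro Λ Brl Ax CoAx Φ Per ι W Dsc Tex En Vol Poly TF n G A c m hTex hPoly hTF hCh
  -- a dominant class: the dominant corner, by name (charge `≥ 1` suffices there)
  by_cases hdom : ∃ f₀ : Fin n, 17 / 20 * Vol n G ≤ (volume (⋃ g ∈ {g : Fin n | A g '' Λ = A f₀ '' Λ}, G g)).toReal
  · exact rung_dominantTwinFree n G A c m hTex hPoly hTF hdom
  classical
  -- class volumes
  obtain ⟨D, -, -, -, -, hV⟩ := twinFree_pincers_charged 2 n G A c m hTex hPoly hTF hCh
  set lat : Fin n → Set E3 := fun f => A f '' Λ with hlat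
  set L : Finset (Set E3) := Finset.univ.image lat with hL
  set v : Set E3 → ℝ := fun ℓ =>
    (volume (⋃ f ∈ Finset.univ.filter (fun f => lat f = ℓ), G f)).toReal with hv
  have hvnn : ∀ ℓ ∈ L, 0 ≤ v ℓ := fun ℓ _ => ENNReal.toReal_nonneg
  have hset : ∀ f₀, (⋃ f ∈ Finset.univ.filter (fun f => lat f = lat f₀), G f) =
      ⋃ g ∈ {g : Fin n | A g '' Λ = A f₀ '' Λ}, G g := by
    intro f₀
    ext x
    simp only [Set.mem_iUnion, Finset.mem_filter, Finset.mem_univ, true_and, Set.mem_setOf_eq,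
      exists_prop, hlat]
  -- no dominant class
  have hnd : ∀ ℓ ∈ L, v ℓ < 17 / 20 * Vol n G := by
    intro ℓ hℓ
    obtain ⟨f₀, -, rfl⟩ := Finset.mem_image.1 hℓ
    by_contra h
    exact hdom ⟨f₀, by rw [← hset f₀]; exact not_lt.1 h⟩
  have hV' : Vol n G = ∑ ℓ ∈ L, v ℓ := hV
  have hbulk : (1.17 : ℝ) * (Vol n G) ^ ((2 : ℝ) / 3) ≤ ∑ ℓ ∈ L, v ℓ ^ ((2 : ℝ) / 3) :=
    sum_rpow_two_thirds_ge_of_noDominant L hV' hvnn hnd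
  exact rung_twinFree_bulk_charged n G A c m hTex hPoly hTF hCh hbulk

end Summit.Ventures.Crystal3D.Cruxes.PolycrystalWulffBound.PolyDensity

end
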